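import Literature.MathematicalPhysics.QuantumFieldTheory.Balaban1983to89.B9PerturbationMajorantAlgebra
import Literature.MathematicalPhysics.QuantumFieldTheory.Balaban1983to89.Node00.OpsYNablaBridge
import Literature.MathematicalPhysics.QuantumFieldTheory.Balaban1983to89.B9RWSumsDefinitePinsPairM
import Literature.MathematicalPhysics.QuantumFieldTheory.Balaban1983to89.B9IndexBondFaithful

/-!
# `Balaban1983to89.B9Thm31GpMajFromPinsPairM` — [B9] p. 421 *"It is easy to find estimates for the operator Δ′_π using Theorem 3.1 …"*:
# THE THEOREM-3.1 LETTER SCHEMA `Thm31GpMaj` OF THE Δ′_π MAJORANTS (rows 20–21) DERIVED FROM ROW 18's THEOREM-3.7 LEAF AT THE SITE PINS,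
# through node00-def-Y's carrier bridge «`D_U` is `∇_U` read on bonds»

T. Bałaban, *Propagators for lattice gauge theories in a background field*, Commun. Math. Phys. **99** (1985) 389–434 [`Balaban1985BackgroundPropagators`,
"B9"]; [4] = T. Bałaban, *Propagators and renormalization transformations for lattice gauge theories. II*, Commun. Math. Phys. **96** (1984) 223–250
[`Balaban1984PropagatorsII`].  statement-level skeleton of published theorems with citation tags; proofs where landed; nothing here is a claim about
the Yang–Mills mass gap.  PDF held (`paper:balaban1985-cmp99-background-propagators`); pp. 397, 409–410, 419–422 re-read.

THE PRINT.  p. 410: *«Theorem 3.7 implies that all the inequalities (3.42)–(3.47) hold for G′»*; p. 397, Theorem 3.1 (3.42): *«|(G′(U)λ)(x)|,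
|(∇_UG′(U)λ)(x)|, |(G′(U)∇\*_Uλ)(x)|, |(Δ_UG′(U)λ)(x)| ≦ B₀[(Lʲη)², Lʲη, Lʲη, 1]e^{−δ₀d(y,y′)}|λ| for x ∈ Δ(y), y ∈ Λ_j, supp λ ⊂ Δ(y′)»*;
p. 390–391, (3.3): *«(D_Uλ)(⟨x, x+ηe_μ⟩) = … = (D_{U,μ}λ)(x)»*; p. 421: *«It is easy to find estimates for the operator Δ′_π using Theorem 3.1 and
the inequality (3.49)»*.

THE POINT (dag-n06-d ASK-3 Q1 for edition 23 of the N06 certificate).  The four displayed Δ′_π majorants `hta htb htaR htbR` of rows 20–21 are, by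
dag-n06-l `B9PerturbationMajorantsAtLettersPhys.hta_of_letters_phys` &c. (knit-side consumer: dag-n06-d `N06SplitMajorantsAtPinsPhys`), consequences of
THREE per-letter schemas; the first of them,
`B9PerturbationMajorantAlgebra.Thm31GpMaj blkW blk (GcoS … G′ U) (DvcoKH … U) (DvscoKH … U) R H B₀ δ₀` (Theorem 3.1 (3.42)₁₂₃ for the site propagator
with def-Y's gauge-sector `D_U ∕ D*_U` models), is NOT new content: row 18 of the same certificate proves Theorem 3.7's leaf `t37` on the `PairM`
E-letter, whose convergence predicate's first conjunct is n06-c's `B9Thm37Whole.Conv342 (𝔬 x) 1 (H x) C δ U` — the THREE sup majorants of `G′`, `∇_UG′`,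
`G′∇*_U` (and `Δ_UG′`) — at the site pins `blk = blkY = blkSK (sIK bI)`, `Gp = GcoS … G′`, `D = DcoS`, `Dstar = DscoS` (n06-d `B9CoReadingCoordsS`);
and node00-def-Y's `Node00.OpsYNablaBridge` (p592017) proves that `DvcoKH ∕ DvscoKH` ARE `DcoS ∕ DscoS` read on bonds ((3.3)₂) and transfers
(3.42)-shaped majorants across for COMPATIBLE block maps (`compat_blkSK_blkBK`: the index-bond map `bI` is blind to the bond's direction).  This file
wires the two:
* §1 `exists_faithful_dirBlind_kIdx` — at every k-level index a level-faithful, carrier-faithful, 1-faithful AND DIRECTION-BLIND index-bond map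
  exists (n06-k `B9IndexBondFaithful.exists_faithful_kIdx` precomposed with `f ↦ ⟨f₋, e₀⟩`; `blkV1` reads `f₋` only): the knit's extra binder
  `hbI0 : ∀ f, bI f = bI ⟨f.src, 0⟩` is dischargeable at the instance together with `hlev hβI hβ1`; `compat_of_dirBlind`;
* §2 ★★ `thm31GpMaj_of_conv342` — ONE member, one `U`: `Conv342 𝔬 R H C δ U` at the five site pins + `hbI0` ⊢
  `Thm31GpMaj (blkSK (sIK bI)) (blkBK bI) (GcoS … O U) (DvcoKH … U) (DvscoKH … U) R H ((d+1)·C) δ` (the direction sum of the e2 transfer costs the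
  factor `d + 1`; `|c_f|·η = 1` by `MemberY.hcfk`); ★★ `thm31GpMaj_of_thm37Printed` — the family form under Theorem 3.7's printed prefix for any leaf
  family whose convergence predicate projects to `Conv342`; ★★★ `thm31GpMaj_of_t37_pairM` — row 18's `E37YPairM` leaf, CLOSED constants in the displayed
  primitives `p`: `B₀ = (d+1)·p.C(exp261 geo9Y p.δ₀ p.α)`, `δ₀ = (1 − 2p.α)·p.δ₀` (at def-Y's record `(lettersYOfRecordV4P …).Gp = GpY … (parSymY …)` is
  `rfl`, so this IS the `h31` of `hta_of_letters_phys` once the knit pins `(𝔬12 x).blkW = blkSK (sIK bI)`, `(𝔬12 x).blk = blkBK bI`);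
HONEST SCOPE.  Finite-dimensional bookkeeping over landed objects; Theorem 3.7's leaf (row 18), (3.49) and (3.117)+(3.36) remain the certificate's
displayed content; nothing of [B9] or [4] is asserted here; count-neutral; N06 NOT discharged; one finite lattice at a time — nothing continuum ∕ ℝ⁴ ∕
OS ∕ mass gap ∕ Clay.  Cell `pub-ymgap` (HUMAN RULING D-0062), Track A node N06 [B9], bundle F7 rows 20–21, seat `pub-ymgap-dag-n06-l` (g15),
2026-08-28.  NEW file; imports def-Y's bridge and n06-k's census BY NAME; nothing landed is modified; 0 `def`.
-/

noncomputable section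

namespace Literature.MathematicalPhysics.QuantumFieldTheory.Balaban1983to89.B9Thm31GpMajFromPinsPairM

open B6RandomWalk (HasMajorant hasMajorant_mono)
open B6RandomWalkHom (HasMajorantHom hasMajorantHom_mono)
open B6GlobalChartV1 (PV blkV1)
open B6Geom246MultiLevelTorus (geomT)
open B6Ineq2142KLevelV1 (lvl β)
open B6KLevelCensusIndexV1 (KIdx)
open B9Thm34Ext (toB6)
open B9Thm37Whole (Ops Conv342)
open B9Cor38Whole (WalkReading)
open B9CoReadingCoords (XBK blkBK)
open B9CoReadingCoordsS (XSK blkSK sIK GcoS DcoS DscoS)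
open B9IndexBondFaithful (exists_faithful_kIdx)
open B9PinMembersKLevelV1 (MemberY geo9Y bg9Y)
open B9GeoLemma21KLevelV1 (geo9Y_len_pos)
open B9RWSumsDefinitePins (PinPrims)
open B9RWSumsDefinitePinsPair (PairPrims)
open B9RWSumsDefinitePinsPairM (MixedPrims E37YPairM)
open B9RWSums347DefiniteFaces (exp261)
open B9PerturbationMajorantAlgebra (Thm31GpMaj)
open Node00 (SiteY FBondY IBondY CfgY SiteOpY CovLettersY etaS)
open Node00.OpsYSectDCoords (DvcoKH DvscoKH)
open Node00.OpsYNablaBridge (chartY compat_blkSK_blkBK abs_cf_mul_etaS_of_hcfk hasMajorantHom_DvcoKH_GcoS_of_compat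
  hasMajorantHom_GcoS_DvscoKH_of_compat)

variable {d ℓ : ℕ} {hd : 1 ≤ d + 1} {hL : Odd (ℓ + 1) ∧ 1 < ℓ + 1} {b₀ b₁ : ℝ} {Mstar : ℕ}

/-! ## §1 Direction-blind faithful index-bond maps exist; compatibility of the two carrier block maps -/

section DirBlind

/-- ★ **AT EVERY k-LEVEL INDEX A LEVEL-FAITHFUL, CARRIER-FAITHFUL, 1-FAITHFUL AND DIRECTION-BLIND INDEX-BOND MAP EXISTS**: n06-k's
`exists_faithful_kIdx` precomposed with `f ↦ ⟨f₋, e₀⟩` (`blkV1 f` is the block of `f₋`, so the three faithfulness properties only see `f₋`).  The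
N06 knit's four geometric binders `hlev hβI hβ1 hbI0` of the coordinate pins are therefore dischargeable at every member.
[cite: Balaban1984PropagatorsII, (2.45)–(2.46) p.231 + p.248 («sites replaced by bonds»); Balaban1985BackgroundPropagators, (3.41) p.397] -/
theorem exists_faithful_dirBlind_kIdx (i : KIdx d ℓ hd hL b₀ b₁) :
    ∃ bI : FBondY i → IBondY i,
      (∀ f : FBondY i, lvl i.hN i.D i.hk (bI f) = (blkV1 i.hN i.D f).1.1) ∧
      (∀ (f : FBondY i) (c : IBondY i), blkV1 i.hN i.D f = β i.hN i.D i.hk c → β i.hN i.D i.hk (bI f) = blkV1 i.hN i.D f) ∧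
      (∀ f : FBondY i, (geomT i.D).dist (β i.hN i.D i.hk (bI f)) (blkV1 i.hN i.D f) ≤ 1) ∧
      (∀ f : FBondY i, bI f = bI ⟨f.src, 0⟩) := by
  obtain ⟨bI, hlev, hβI, hβ1⟩ := exists_faithful_kIdx i
  exact ⟨fun f => bI ⟨f.src, 0⟩, fun f => hlev _, fun f c hc => hβI _ c hc, fun f => hβ1 _, fun _ => rfl⟩

/-- a direction-blind index-bond map in the `(x, μ)` spelling of def-Y's `compat_blkSK_blkBK`. [cite: Balaban1984PropagatorsII, (2.45) p.231, bookkeeping] -/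
theorem dirBlind_apply {i : KIdx d ℓ hd hL b₀ b₁} {bI : FBondY i → IBondY i} (hbI0 : ∀ f : FBondY i, bI f = bI ⟨f.src, 0⟩)
    (x : Site (PV d ℓ i.m i.K hd hL) 0) (μ : Fin (d + 1)) : bI ⟨x, μ⟩ = bI ⟨x, 0⟩ :=
  hbI0 ⟨x, μ⟩

/-- ★ **for a direction-blind `bI` the site-carrier block map `blkSK (sIK bI)` and the bond-carrier block map `blkBK bI` are COMPATIBLE** (def-Y's
hypothesis `hSB`). [cite: Balaban1984PropagatorsII, (2.45) p.231 + p.248, bookkeeping] -/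
theorem compat_of_dirBlind {κ : Type} (i : KIdx d ℓ hd hL b₀ b₁) {bI : FBondY i → IBondY i} (hbI0 : ∀ f : FBondY i, bI f = bI ⟨f.src, 0⟩)
    (x : Site (PV d ℓ i.m i.K hd hL) 0) (μ μ' ν : Fin (d + 1)) (a c : κ) :
    blkSK (κ := κ) i (sIK i bI) (chartY i x, μ', a, c) = blkBK (κ := κ) i bI (⟨x, μ⟩, ν, a, c) :=
  compat_blkSK_blkBK i (dirBlind_apply hbI0) x μ μ' ν a c

end DirBlind

/-! ## §2 `Thm31GpMaj` from `Conv342` at the site pins, one member; the family form; row 18's `PairM` leaf -/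

section OneMember

variable {𝔸 : Type} [NormedRing 𝔸] [NormedAlgebra ℂ 𝔸] [CompleteSpace 𝔸] [FiniteDimensional ℝ 𝔸]
variable {κ : Type} [Fintype κ]

/-- `1 ≤ d + 1` in `ℝ`. [cite: Balaban1985BackgroundPropagators, (3.42) p.397, bookkeeping] -/
private theorem one_le_dsucc : (1 : ℝ) ≤ ((d + 1 : ℕ) : ℝ) := by
  exact_mod_cast Nat.succ_le_succ (Nat.zero_le d)

/-- ★★ **`Thm31GpMaj` AT ONE MEMBER FROM n06-c's `Conv342` AT THE SITE PINS** (p. 410 «Theorem 3.7 implies (3.42)» + (3.3)₂ «D_U is ∇_U read on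
bonds»): the three sup conjuncts of `Conv342 𝔬 R H C δ U` (block majorants `C(Lʲη)²e^{−δd}` of `G′`, `C·Lʲη·e^{−δd}` of `∇_UG′` and of `G′∇*_U`) at the pins
`blk = blkY = blkSK (sIK bI)`, `Gp = GcoS … O`, `D = DcoS`, `Dstar = DscoS`, for a DIRECTION-BLIND `bI`, give the Theorem-3.1 letter schema of the Δ′_π
majorants for the site propagator model `GcoS … O U` with def-Y's gauge-sector models `DvcoKH ∕ DvscoKH` between the site carrier `blkSK (sIK bI)` and
the bond carrier `blkBK bI`, constants `B₀ = (d+1)·C`, `δ₀ = δ` (e0 verbatim; e1∕e2 by def-Y's compatible transfers, `|c_f|η = 1`).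
[cite: Balaban1985BackgroundPropagators, Thm 3.1 (3.42) p.397 ⇐ Thm 3.7 p.409 («Theorem 3.7 implies (3.42)–(3.47)» p.410); (3.3) pp.390–391, (3.8) p.392] -/
theorem thm31GpMaj_of_conv342 (x : MemberY d ℓ hd hL b₀ b₁ Mstar) [Fintype (geo9Y x).Site] (b : Module.Basis κ ℝ 𝔸)
    (B : B9.Backgrounds) (cfg : B.Cfg → CfgY 𝔸 x.toKIdx) (O : SiteOpY 𝔸 x.toKIdx) {ι : Type}
    (𝔬 : Ops (geo9Y x) B (XSK κ x.toKIdx) (XSK κ x.toKIdx) ι) {R : ℝ} {H : Prop} {C δ : ℝ} (hC : 0 ≤ C) {U : B.Cfg}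
    (hconv : Conv342 𝔬 R H C δ U)
    {bI : FBondY x.toKIdx → IBondY x.toKIdx} (hbI0 : ∀ f : FBondY x.toKIdx, bI f = bI ⟨f.src, 0⟩)
    (hblkS : 𝔬.blk = blkSK x.toKIdx (sIK x.toKIdx bI)) (hblkYS : 𝔬.blkY = blkSK x.toKIdx (sIK x.toKIdx bI))
    (hGpS : 𝔬.Gp U = GcoS x.toKIdx b B cfg O U) (hDS : 𝔬.D U = DcoS x.toKIdx b B cfg U) (hDsS : 𝔬.Dstar U = DscoS x.toKIdx b B cfg U) :
    Thm31GpMaj (g := geo9Y x) (blkSK x.toKIdx (sIK x.toKIdx bI)) (blkBK x.toKIdx bI) (GcoS x.toKIdx b B cfg O U)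
      (DvcoKH x.toKIdx b B cfg U) (DvscoKH x.toKIdx b B cfg U) R H (((d + 1 : ℕ) : ℝ) * C) δ := by
  obtain ⟨h0, h1, h2, -⟩ := hconv
  rw [hblkS, hGpS] at h0
  rw [hblkS, hblkYS, hGpS, hDS] at h1
  rw [hblkS, hblkYS, hGpS, hDsS] at h2
  have hSB := compat_of_dirBlind (κ := κ) x.toKIdx hbI0
  have hcf : |x.cf| * etaS x.toKIdx = 1 := abs_cf_mul_etaS_of_hcfk x.toKIdx x.hcfk
  have hCle : C ≤ ((d + 1 : ℕ) : ℝ) * C := le_mul_of_one_le_left hC one_le_dsucc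
  refine ⟨?_, ?_, ?_⟩
  · exact hasMajorant_mono _ h0 fun a a' =>
      mul_le_mul_of_nonneg_right (mul_le_mul_of_nonneg_right hCle (sq_nonneg _)) (Real.exp_nonneg _)
  · refine hasMajorantHom_mono _ _ (hasMajorantHom_DvcoKH_GcoS_of_compat x.toKIdx b B cfg O hSB U h1) fun a a' => ?_
    show |x.cf| * etaS x.toKIdx * (C * (geo9Y x).len a * Real.exp (-(δ * (geo9Y x).dist a a'))) ≤ _
    rw [hcf, one_mul]
    exact mul_le_mul_of_nonneg_right (mul_le_mul_of_nonneg_right hCle (geo9Y_len_pos x a).le) (Real.exp_nonneg _)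
  · refine hasMajorantHom_mono _ _ (hasMajorantHom_GcoS_DvscoKH_of_compat x.toKIdx b B cfg O hSB U h2) fun a a' => le_of_eq ?_
    show ((d + 1 : ℕ) : ℝ) * (|x.cf| * etaS x.toKIdx) * (C * (geo9Y x).len a * Real.exp (-(δ * (geo9Y x).dist a a'))) = _
    rw [hcf]
    ring

end OneMember

section Family

variable {𝔸 : Type} [NormedRing 𝔸] [NormedAlgebra ℂ 𝔸] [CompleteSpace 𝔸] [FiniteDimensional ℝ 𝔸]
variable {κ : Type} [Fintype κ]
variable [∀ x : MemberY d ℓ hd hL b₀ b₁ Mstar, Fintype (geo9Y x).Site]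

/-- ★★ **THE FAMILY FORM UNDER THEOREM 3.7's PRINTED PREFIX**: for ANY leaf family `E` satisfying `B9.Thm37Printed c35 geo9Y bg9Y E` whose convergence
predicate projects to `Conv342 (𝔬 x) (R x) (H x) C δ` (`0 ≤ C`), the site pins and a direction-blind `bI`, EVERY member above the leaf's threshold
(`M₂ ≤ M`, `0 < α₀`, `Mα₀ ≤ a₀`, `U` in (3.35)) has `Thm31GpMaj (blkSK (sIK bI)) (blkBK bI) (GcoS … (𝔏 x).Gp U) (DvcoKH … U) (DvscoKH … U) (R x) (H x) ((d+1)C) δ`.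
[cite: Balaban1985BackgroundPropagators, Thm 3.7 p.409 + «Theorem 3.7 implies (3.42)–(3.47)» p.410; Thm 3.1 (3.42) p.397] -/
theorem thm31GpMaj_of_thm37Printed {G : Subgroup 𝔸ˣ} (b : Module.Basis κ ℝ 𝔸) {c35 : ℝ}
    (𝔏 : ∀ x : MemberY d ℓ hd hL b₀ b₁ Mstar, CovLettersY 𝔸 x) {ι : MemberY d ℓ hd hL b₀ b₁ Mstar → Type}
    (𝔬 : ∀ x : MemberY d ℓ hd hL b₀ b₁ Mstar, Ops (geo9Y x) (bg9Y 𝔸 G x) (XSK κ x.toKIdx) (XSK κ x.toKIdx) (ι x))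
    (E : ∀ x : MemberY d ℓ hd hL b₀ b₁ Mstar, B9.RWExpansion (geo9Y x) (bg9Y 𝔸 G x))
    (t37 : B9.Thm37Printed c35 (fun x : MemberY d ℓ hd hL b₀ b₁ Mstar => geo9Y x) (fun x => bg9Y 𝔸 G x) E)
    {R : MemberY d ℓ hd hL b₀ b₁ Mstar → ℝ} {H : MemberY d ℓ hd hL b₀ b₁ Mstar → Prop} {C δ : ℝ} (hC : 0 ≤ C)
    (hconv : ∀ (x : MemberY d ℓ hd hL b₀ b₁ Mstar) (U : (bg9Y 𝔸 G x).Cfg), (E x).Converges U → Conv342 (𝔬 x) (R x) (H x) C δ U)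
    {bI : ∀ x : MemberY d ℓ hd hL b₀ b₁ Mstar, FBondY x.toKIdx → IBondY x.toKIdx}
    (hbI0 : ∀ (x : MemberY d ℓ hd hL b₀ b₁ Mstar) (f : FBondY x.toKIdx), bI x f = bI x ⟨f.src, 0⟩)
    (hblkS : ∀ x : MemberY d ℓ hd hL b₀ b₁ Mstar, (𝔬 x).blk = blkSK x.toKIdx (sIK x.toKIdx (bI x)))
    (hblkYS : ∀ x : MemberY d ℓ hd hL b₀ b₁ Mstar, (𝔬 x).blkY = blkSK x.toKIdx (sIK x.toKIdx (bI x)))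
    (hGpS : ∀ (x : MemberY d ℓ hd hL b₀ b₁ Mstar) (U : (bg9Y 𝔸 G x).Cfg), (𝔬 x).Gp U = GcoS x.toKIdx b (bg9Y 𝔸 G x) (fun U => U) (𝔏 x).Gp U)
    (hDS : ∀ (x : MemberY d ℓ hd hL b₀ b₁ Mstar) (U : (bg9Y 𝔸 G x).Cfg), (𝔬 x).D U = DcoS x.toKIdx b (bg9Y 𝔸 G x) (fun U => U) U)
    (hDsS : ∀ (x : MemberY d ℓ hd hL b₀ b₁ Mstar) (U : (bg9Y 𝔸 G x).Cfg), (𝔬 x).Dstar U = DscoS x.toKIdx b (bg9Y 𝔸 G x) (fun U => U) U) :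
    ∃ M₂ a₀ : ℝ, 0 < M₂ ∧ 0 < a₀ ∧
      ∀ x : MemberY d ℓ hd hL b₀ b₁ Mstar, M₂ ≤ (geo9Y x).M → ∀ α₀ : ℝ, 0 < α₀ → (geo9Y x).M * α₀ ≤ a₀ →
        ∀ U : (bg9Y 𝔸 G x).Cfg, (bg9Y 𝔸 G x).Reg335 c35 α₀ U →
          Thm31GpMaj (g := geo9Y x) (blkSK x.toKIdx (sIK x.toKIdx (bI x))) (blkBK x.toKIdx (bI x))
            (GcoS x.toKIdx b (bg9Y 𝔸 G x) (fun U => U) (𝔏 x).Gp U)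
            (DvcoKH x.toKIdx b (bg9Y 𝔸 G x) (fun U => U) U) (DvscoKH x.toKIdx b (bg9Y 𝔸 G x) (fun U => U) U)
            (R x) (H x) (((d + 1 : ℕ) : ℝ) * C) δ := by
  obtain ⟨M₂, a₀, hM₂, ha₀, H37⟩ := t37
  exact ⟨M₂, a₀, hM₂, ha₀, fun x hM α₀ hα₀ hMa U hU =>
    thm31GpMaj_of_conv342 x b (bg9Y 𝔸 G x) (fun U => U) (𝔏 x).Gp (𝔬 x) hC (hconv x U (H37 x hM α₀ hα₀ hMa U hU)) (hbI0 x)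
      (hblkS x) (hblkYS x) (hGpS x U) (hDS x U) (hDsS x U)⟩

/-- ★★★ **ROW 18's LEAF ON THE `PairM` E-LETTER ⟹ THE THEOREM-3.1 LETTER SCHEMA OF ROWS 20–21's Δ′_π MAJORANTS, CLOSED CONSTANTS** (dag-n06-d ASK-3 Q1):
`E37YPairM … (𝔬 x) (rd x) (H x) (K x)` is `E37AllOfOps …` with convergence predicate `ConvAll342`, first conjunct
`Conv342 (𝔬 x) 1 (H x) (p.C (exp261 geo9Y p.δ₀ p.α)) ((1 − 2p.α)p.δ₀) U`; hence, with the site pins and a direction-blind `bI`, every member above the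
leaf's threshold has `Thm31GpMaj (blkSK (sIK bI)) (blkBK bI) (GcoS … (𝔏 x).Gp U) (DvcoKH … U) (DvscoKH … U) 1 (H x) ((d+1)·p.C(exp261 geo9Y p.δ₀ p.α))
((1 − 2p.α)·p.δ₀)` — at def-Y's record `(lettersYOfRecordV4P …).Gp = GpY … (parSymY …)` (`rfl`), the `h31` hypothesis of
`B9PerturbationMajorantsAtLettersPhys.hta_of_letters_phys` & co.
[cite: Balaban1985BackgroundPropagators, Thm 3.1 (3.42) p.397 ⇐ Thm 3.7 pp.409–410; p.421 («using Theorem 3.1»); (3.3) pp.390–391] -/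
theorem thm31GpMaj_of_t37_pairM {G : Subgroup 𝔸ˣ} (b : Module.Basis κ ℝ 𝔸) {c35 : ℝ}
    (𝔏 : ∀ x : MemberY d ℓ hd hL b₀ b₁ Mstar, CovLettersY 𝔸 x) {ι : MemberY d ℓ hd hL b₀ b₁ Mstar → Type}
    (𝔬 : ∀ x : MemberY d ℓ hd hL b₀ b₁ Mstar, Ops (geo9Y x) (bg9Y 𝔸 G x) (XSK κ x.toKIdx) (XSK κ x.toKIdx) (ι x))
    (rd : ∀ x : MemberY d ℓ hd hL b₀ b₁ Mstar, WalkReading (geo9Y x) (bg9Y 𝔸 G x) (XSK κ x.toKIdx) (ι x))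
    (H : MemberY d ℓ hd hL b₀ b₁ Mstar → Prop) {m mN' : ℕ} {Cev NQ : ℝ} {p q : PinPrims} (hp : p.OK) {p3 q3 : PairPrims} {pM qM : MixedPrims}
    {K : ∀ x : MemberY d ℓ hd hL b₀ b₁ Mstar, B9.KernelFamily (geo9Y x) (bg9Y 𝔸 G x)}
    (t37 : B9.Thm37Printed c35 (fun x : MemberY d ℓ hd hL b₀ b₁ Mstar => geo9Y x) (fun x => bg9Y 𝔸 G x)
      (fun x => E37YPairM (bg := bg9Y 𝔸 G) m mN' Cev NQ p q p3 q3 pM qM (𝔬 x) (rd x) (H x) (K x)))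
    {bI : ∀ x : MemberY d ℓ hd hL b₀ b₁ Mstar, FBondY x.toKIdx → IBondY x.toKIdx}
    (hbI0 : ∀ (x : MemberY d ℓ hd hL b₀ b₁ Mstar) (f : FBondY x.toKIdx), bI x f = bI x ⟨f.src, 0⟩)
    (hblkS : ∀ x : MemberY d ℓ hd hL b₀ b₁ Mstar, (𝔬 x).blk = blkSK x.toKIdx (sIK x.toKIdx (bI x)))
    (hblkYS : ∀ x : MemberY d ℓ hd hL b₀ b₁ Mstar, (𝔬 x).blkY = blkSK x.toKIdx (sIK x.toKIdx (bI x)))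
    (hGpS : ∀ (x : MemberY d ℓ hd hL b₀ b₁ Mstar) (U : (bg9Y 𝔸 G x).Cfg), (𝔬 x).Gp U = GcoS x.toKIdx b (bg9Y 𝔸 G x) (fun U => U) (𝔏 x).Gp U)
    (hDS : ∀ (x : MemberY d ℓ hd hL b₀ b₁ Mstar) (U : (bg9Y 𝔸 G x).Cfg), (𝔬 x).D U = DcoS x.toKIdx b (bg9Y 𝔸 G x) (fun U => U) U)
    (hDsS : ∀ (x : MemberY d ℓ hd hL b₀ b₁ Mstar) (U : (bg9Y 𝔸 G x).Cfg), (𝔬 x).Dstar U = DscoS x.toKIdx b (bg9Y 𝔸 G x) (fun U => U) U) :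
    ∃ M₂ a₀ : ℝ, 0 < M₂ ∧ 0 < a₀ ∧
      ∀ x : MemberY d ℓ hd hL b₀ b₁ Mstar, M₂ ≤ (geo9Y x).M → ∀ α₀ : ℝ, 0 < α₀ → (geo9Y x).M * α₀ ≤ a₀ →
        ∀ U : (bg9Y 𝔸 G x).Cfg, (bg9Y 𝔸 G x).Reg335 c35 α₀ U →
          Thm31GpMaj (g := geo9Y x) (blkSK x.toKIdx (sIK x.toKIdx (bI x))) (blkBK x.toKIdx (bI x))
            (GcoS x.toKIdx b (bg9Y 𝔸 G x) (fun U => U) (𝔏 x).Gp U)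
            (DvcoKH x.toKIdx b (bg9Y 𝔸 G x) (fun U => U) U) (DvscoKH x.toKIdx b (bg9Y 𝔸 G x) (fun U => U) U)
            1 (H x) (((d + 1 : ℕ) : ℝ) * p.C (exp261 (@geo9Y d ℓ hd hL b₀ b₁ Mstar) p.δ₀ p.α)) ((1 - 2 * p.α) * p.δ₀) :=
  thm31GpMaj_of_thm37Printed (R := fun _ => (1 : ℝ)) b 𝔏 𝔬 _ t37 (p.C_nonneg hp _) (fun _ _ h => h.1) hbI0 hblkS hblkYS hGpS hDS hDsS

end Family


end Literature.MathematicalPhysics.QuantumFieldTheory.Balaban1983to89.B9Thm31GpMajFromPinsPairM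

end
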